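import Literature.MathematicalPhysics.QuantumManyBody.GroundStateFeynmanKacPositivity
import HarnessLib

/-!
# Ground-state Feynman–Kac: the Perron–Frobenius theorem for `e^{-tH_N}` on `L²(Λ_L^N)`

Topic `Literature/MathematicalPhysics/QuantumManyBody`; theorems only. Step of the proof of the
named fact `Literature.MathematicalPhysics.QuantumManyBody.BoseGas.GroundStateFeynmanKac`: the
abstract argument of Reed–Simon IV Thm XIII.44 / Glimm–Jaffe Thms 3.3.2–3.3.3 ("positivity
improving ⇒ the ground state is unique and strictly positive"), run for the compact positive
self-adjoint positivity-improving operator `T = fkL2 v L t` (`GroundStateFeynmanKacCompact`,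
`GroundStateFeynmanKacPositivity`):

* `inner_Lp_eq_integral` — `⟪f, g⟫ = ∫ f g`;
* `inner_fkL2_le_inner_abs` — `⟪T f, f⟫ ≤ ⟪T |f|, |f|⟫` (`|T f| ≤ T |f|`);
* `fkL2_abs_eigenvector` — if `T φ = ‖T‖ φ` then `T |φ| = ‖T‖ |φ|`;
* `fkL2_coeFn_pos` — positivity improving on `L²(Λ)`: `0 ≤ u ≠ 0 ⇒ T u > 0` a.e.;
* `fkL2_perronFrobenius` — **`T` has the eigenvalue `‖T‖ > 0` with a unit eigenvector `e ≥ 0`,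
  a.e. strictly positive on the box, spanning the `‖T‖`-eigenspace.**

## References

* M. Reed, B. Simon, *Methods of Modern Mathematical Physics IV* (1978), Thm XIII.44.
  [ReedSimonIV1978]
* J. Glimm, A. Jaffe, *Quantum Physics* (1987), Thms 3.3.2–3.3.3. [GlimmJaffeQP1987]
* K. L. Chung, Z. Zhao, *From Brownian Motion to Schrödinger's Equation* (1995), Thm 8.11 and
  its Corollary. [ChungZhao1995]
-/

noncomputable section

namespace Literature.MathematicalPhysics.QuantumManyBody.BoseGas

open MeasureTheory ProbabilityTheory Filter Set Metric
open scoped ENNReal NNReal Topology InnerProductSpace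
open Literature.Probability.Process

variable {N : ℕ}

/-! ### `L²(Λ)` bookkeeping -/

/-- `⟪f, g⟫ = ∫ f g` on real `L²`. [folklore] -/
theorem inner_Lp_eq_integral {α : Type*} [MeasurableSpace α] {μ : Measure α} (f g : Lp ℝ 2 μ) :
    ⟪f, g⟫_ℝ = ∫ x, f x * g x ∂μ := by
  rw [L2.inner_def]
  refine integral_congr_ae (Eventually.of_forall fun x => ?_)
  simp only [RCLike.inner_apply, conj_trivial]
  ring

/-- The box has positive Lebesgue measure (`L > 0`), so `L²(Λ)` lives on a nonzero measure.
[folklore] -/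
theorem restrict_boxN_ne_zero (N : ℕ) {L : ℝ} (hL : 0 < L) :
    (volume.restrict (boxN N L) : Measure (Config N)) ≠ 0 := by
  rw [Ne, Measure.restrict_eq_zero]
  have hne : (boxN N L).Nonempty := ⟨fun _ => WithLp.toLp 2 (fun _ => L / 2), fun i k => by
    simp only [Set.mem_Ioo]; constructor <;> linarith⟩
  exact ((isOpen_boxN N L).measure_pos volume hne).ne'

/-- **Strictly positive a.e. pairings**: if `e > 0` and `f > 0` a.e. then `⟪e, f⟫ > 0`. [folklore] -/
theorem inner_pos_of_ae_pos {α : Type*} [MeasurableSpace α] {μ : Measure α} (hμ : μ ≠ 0)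
    {e f : Lp ℝ 2 μ} (he : ∀ᵐ x ∂μ, 0 < e x) (hf : ∀ᵐ x ∂μ, 0 < f x) : 0 < ⟪e, f⟫_ℝ := by
  rw [inner_Lp_eq_integral]
  have hprod : ∀ᵐ x ∂μ, 0 < e x * f x := by
    filter_upwards [he, hf] with x h1 h2 using mul_pos h1 h2
  rw [integral_pos_iff_support_of_nonneg_ae (hprod.mono fun x hx => hx.le)
    ((Lp.memLp e).integrable_mul (Lp.memLp f))]
  have hfull : μ (Function.support fun x => e x * f x)ᶜ = 0 := by
    refine measure_mono_null (fun x hx => ?_) (ae_iff.1 hprod)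
    simp only [Set.mem_compl_iff, Function.mem_support, not_not] at hx
    simp [hx]
  have h1 : μ Set.univ ≤ μ (Function.support fun x => e x * f x) := by
    calc μ Set.univ = μ ((Function.support fun x => e x * f x) ∪
          (Function.support fun x => e x * f x)ᶜ) := by rw [Set.union_compl_self]
      _ ≤ μ (Function.support fun x => e x * f x) + μ (Function.support fun x => e x * f x)ᶜ :=
          measure_union_le _ _
      _ = μ (Function.support fun x => e x * f x) := by rw [hfull, add_zero]
  exact lt_of_lt_of_le (Measure.measure_univ_pos.2 hμ) h1

/-! ### `|T f| ≤ T |f|` consequences -/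

/-- **`⟪T f, f⟫ ≤ ⟪T |f|, |f|⟫`** for `T = e^{-tH}` on `L²(Λ)` (`|T f| ≤ T |f|` a.e.). [folklore] -/
theorem inner_fkL2_le_inner_abs {v : ℝ → ℝ≥0∞} (hv : Measurable v) (L : ℝ) {t : ℝ} (ht : 0 < t)
    (f : Lp ℝ 2 (volume.restrict (boxN N L))) :
    ⟪fkL2 v L t f, f⟫_ℝ ≤ ⟪fkL2 v L t |f|, |f|⟫_ℝ := by
  rw [inner_Lp_eq_integral, inner_Lp_eq_integral]
  refine integral_mono_ae ((Lp.memLp _).integrable_mul (Lp.memLp f))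
    ((Lp.memLp _).integrable_mul (Lp.memLp |f|)) ?_
  have hle := (Lp.coeFn_le _ _).2 (abs_fkL2_le hv L ht f)
  filter_upwards [hle, Lp.coeFn_abs (fkL2 v L t f), Lp.coeFn_abs f] with X h1 h2 h3
  rw [h3]
  calc (fkL2 v L t f : Config N → ℝ) X * f X ≤ |(fkL2 v L t f : Config N → ℝ) X| * |f X| := by
        rw [← abs_mul]; exact le_abs_self _
    _ ≤ (fkL2 v L t |f| : Config N → ℝ) X * |f X| := by
        refine mul_le_mul_of_nonneg_right ?_ (abs_nonneg _)
        rw [← h2]; exact h1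

/-- **The absolute value of an eigenvector for `‖T‖` is again one**: `T φ = ‖T‖ φ ⇒ T |φ| = ‖T‖ |φ|`
(`|φ|/‖φ‖` maximises the Rayleigh quotient). Reed–Simon IV, proof of Thm XIII.44. [folklore] -/
theorem fkL2_abs_eigenvector {v : ℝ → ℝ≥0∞} (hv : Measurable v) (L : ℝ) {t : ℝ} (ht : 0 < t)
    {φ : Lp ℝ 2 (volume.restrict (boxN N L))}
    (hφ : fkL2 v L t φ = ‖fkL2 (N := N) v L t‖ • φ) : fkL2 v L t |φ| = ‖fkL2 (N := N) v L t‖ • |φ| := by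
  set T := fkL2 v L t with hT
  rcases eq_or_ne φ 0 with rfl | hφ0
  · simp
  · have hn : 0 < ‖φ‖ := norm_pos_iff.2 hφ0
    have hna : ‖|φ|‖ = ‖φ‖ := norm_abs_eq_norm φ
    set ψ : Lp ℝ 2 (volume.restrict (boxN N L)) := ‖φ‖⁻¹ • |φ| with hψ
    have hψ1 : ‖ψ‖ = 1 := by
      rw [hψ, norm_smul, norm_inv, norm_norm, hna, inv_mul_cancel₀ hn.ne']
    have hray : ⟪T ψ, ψ⟫_ℝ = ‖T‖ := by
      refine le_antisymm (rayleigh_le_opNorm T hψ1) ?_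
      have h1 : ⟪T φ, φ⟫_ℝ = ‖T‖ * ‖φ‖ ^ 2 := by
        rw [hφ, inner_smul_left, real_inner_self_eq_norm_sq]; simp
      have h2 := inner_fkL2_le_inner_abs hv L ht φ
      rw [hψ, map_smul, inner_smul_left, inner_smul_right]
      simp only [conj_trivial]
      rw [h1] at h2
      have : ‖T‖ = ‖φ‖⁻¹ * (‖φ‖⁻¹ * (‖T‖ * ‖φ‖ ^ 2)) := by field_simp
      rw [this]
      gcongr
    have heig := eq_smul_of_rayleigh_eq_norm T hψ1 hray
    -- unscale
    rw [hψ, map_smul, smul_smul] at heig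
    have h2 := congrArg (fun x : Lp ℝ 2 (volume.restrict (boxN N L)) => ‖φ‖ • x) heig
    simp only [smul_smul, mul_inv_cancel₀ hn.ne', one_smul] at h2
    rw [h2]
    congr 1
    field_simp

/-- **Positivity improving on `L²(Λ)`**: for `0 ≤ u ≠ 0`, `(e^{-tH} u)(X) > 0` for a.e. `X ∈ Λ`
(`L > 0`? not needed: positivity at every point of the box, `fkReal_pos_of_nonneg`). [folklore] -/
theorem fkL2_coeFn_pos {v : ℝ → ℝ≥0∞} (hv : Measurable v) {C : ℝ≥0} (hC : ∀ r, v r ≤ C) (L : ℝ)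
    {t : ℝ} (ht : 0 < t) {u : Lp ℝ 2 (volume.restrict (boxN N L))} (hu0 : 0 ≤ u) (hu : u ≠ 0) :
    ∀ᵐ X ∂volume.restrict (boxN N L), 0 < (fkL2 v L t u : Config N → ℝ) X := by
  -- a nonnegative measurable representative
  set g : Config N → ℝ := fun Y => max (u Y) 0 with hg
  have hgm : Measurable g := (measurable_coeFn_Lp u).max measurable_const
  have hg0 : ∀ Y, 0 ≤ g Y := fun Y => le_max_right _ _
  have hgu : (u : Config N → ℝ) =ᵐ[volume.restrict (boxN N L)] g := by
    filter_upwards [(Lp.coeFn_nonneg u).2 hu0] with Y hY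
    exact (max_eq_left hY).symm
  have hg2 : ∫⁻ Y in boxN N L, ‖g Y‖ₑ ^ (2 : ℝ) ≠ ⊤ :=
    setLIntegral_enorm_posPart_sq_ne_top L (setLIntegral_enorm_sq_ne_top u)
  have hne : ¬ g =ᵐ[volume.restrict (boxN N L)] 0 := by
    intro h0
    exact hu (Lp.eq_zero_iff_ae_eq_zero.2 (hgu.trans h0))
  have hpos : ∀ X ∈ boxN N L, 0 < fkReal v L t g X := fun X hX =>
    fkReal_pos_of_nonneg hv hC ht hgm hg0 hg2 hne hX
  filter_upwards [fkL2_coeFn hv L ht u, ae_restrict_mem (measurableSet_boxN N L)] with X hX hXD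
  rw [hX, fkReal_congr_ae_restrict v L ht hgu X]
  exact hpos X hXD

/-- A nonnegative nonzero eigenvector for `‖T‖` is a.e. strictly positive on the box. [folklore] -/
theorem fkL2_coeFn_pos_of_eigenvector {v : ℝ → ℝ≥0∞} (hv : Measurable v) {C : ℝ≥0}
    (hC : ∀ r, v r ≤ C) (L : ℝ) {t : ℝ} (ht : 0 < t) (hT : fkL2 (N := N) v L t ≠ 0)
    {φ : Lp ℝ 2 (volume.restrict (boxN N L))} (hφ0 : 0 ≤ φ) (hφ : φ ≠ 0)
    (heig : fkL2 v L t φ = ‖fkL2 (N := N) v L t‖ • φ) :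
    ∀ᵐ X ∂volume.restrict (boxN N L), 0 < (φ : Config N → ℝ) X := by
  have hTn : 0 < ‖fkL2 (N := N) v L t‖ := norm_pos_iff.2 hT
  filter_upwards [fkL2_coeFn_pos hv hC L ht hφ0 hφ, Lp.coeFn_smul ‖fkL2 (N := N) v L t‖ φ] with X h1 h2
  rw [heig, h2, Pi.smul_apply, smul_eq_mul] at h1
  exact pos_of_mul_pos_right h1 hTn.le |> fun h => (mul_pos_iff_of_pos_left hTn).1 h1

/-! ### The Perron–Frobenius theorem -/

set_option maxHeartbeats 800000 in
/-- **Simplicity from positivity improving**: if `e` is a unit eigenvector for `‖T‖` which is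
a.e. strictly positive, then every eigenvector for `‖T‖` is a multiple of `e` (otherwise
`f - ⟪e, f⟫ e` would be a nonzero eigenvector orthogonal to `e`, but nonzero eigenvectors have a
strict sign a.e.). Reed–Simon IV Thm XIII.44. [folklore] -/
theorem fkL2_eigenvector_smul_of_pos {v : ℝ → ℝ≥0∞} (hv : Measurable v) {C : ℝ≥0} (hC : ∀ r, v r ≤ C)
    {L : ℝ} (hL : 0 < L) {t : ℝ} (ht : 0 < t) (hT0 : fkL2 (N := N) v L t ≠ 0)
    {e : Lp ℝ 2 (volume.restrict (boxN N L))} (he1 : ‖e‖ = 1)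
    (hTe : fkL2 v L t e = ‖fkL2 (N := N) v L t‖ • e)
    (hepos : ∀ᵐ X ∂volume.restrict (boxN N L), 0 < (e : Config N → ℝ) X)
    (f : Lp ℝ 2 (volume.restrict (boxN N L))) (hf : fkL2 v L t f = ‖fkL2 (N := N) v L t‖ • f) :
    ∃ c : ℝ, f = c • e := by
  have hμ0 : (volume.restrict (boxN N L) : Measure (Config N)) ≠ 0 := restrict_boxN_ne_zero N hL
  haveI : (ae (volume.restrict (boxN N L) : Measure (Config N))).NeBot := ae_neBot.2 hμ0
  set c : ℝ := ⟪e, f⟫_ℝ with hc'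
  set f' : Lp ℝ 2 (volume.restrict (boxN N L)) := f - c • e with hf'
  have hf'eig : fkL2 v L t f' = ‖fkL2 (N := N) v L t‖ • f' := by
    rw [hf', (fkL2 (N := N) v L t).map_sub, (fkL2 (N := N) v L t).map_smul, hf, hTe, smul_sub, smul_comm]
  have hf'e : ⟪e, f'⟫_ℝ = 0 := by
    rw [hf', inner_sub_right, inner_smul_right, real_inner_self_eq_norm_sq, he1]; simp [hc']
  clear_value c f'
  by_cases hz : f' = 0
  · exact ⟨c, by rwa [hf', sub_eq_zero] at hz⟩
  · exfalso
    have habs : fkL2 v L t |f'| = ‖fkL2 (N := N) v L t‖ • |f'| := fkL2_abs_eigenvector hv L ht hf'eig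
    -- positive and negative parts of the representative, as `L²` classes
    set r : Config N → ℝ := (f' : Config N → ℝ) with hr
    have hrm : Measurable r := measurable_coeFn_Lp f'
    have hpm : MemLp (fun X => max (r X) 0) 2 (volume.restrict (boxN N L)) := (Lp.memLp f').pos_part
    have hqm : MemLp (fun X => max (-r X) 0) 2 (volume.restrict (boxN N L)) := (Lp.memLp f').neg_part
    obtain ⟨p, hpdef⟩ : ∃ p : Lp ℝ 2 (volume.restrict (boxN N L)), p = hpm.toLp _ := ⟨_, rfl⟩
    obtain ⟨q, hqdef⟩ : ∃ q : Lp ℝ 2 (volume.restrict (boxN N L)), q = hqm.toLp _ := ⟨_, rfl⟩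
    have hpc : (p : Config N → ℝ) =ᵐ[volume.restrict (boxN N L)] fun X => max (r X) 0 := by
      rw [hpdef]; exact hpm.coeFn_toLp
    have hqc : (q : Config N → ℝ) =ᵐ[volume.restrict (boxN N L)] fun X => max (-r X) 0 := by
      rw [hqdef]; exact hqm.coeFn_toLp
    -- `p = ½ (|f'| + f')`, `q = ½ (|f'| + (-f'))`
    have hp_eq : p = (1 / 2 : ℝ) • (|f'| + f') := by
      refine Lp.ext ?_
      filter_upwards [hpc, Lp.coeFn_smul (1 / 2 : ℝ) (|f'| + f'), Lp.coeFn_add |f'| f',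
        Lp.coeFn_abs f'] with X h1 h2 h3 h4
      rw [h1, h2, Pi.smul_apply, h3, Pi.add_apply, h4, smul_eq_mul]
      rcases le_total 0 (r X) with h | h
      · rw [max_eq_left h, abs_of_nonneg h]; ring
      · rw [max_eq_right h, abs_of_nonpos h]; ring
    have hq_eq : q = (1 / 2 : ℝ) • (|f'| + -f') := by
      refine Lp.ext ?_
      filter_upwards [hqc, Lp.coeFn_smul (1 / 2 : ℝ) (|f'| + -f'), Lp.coeFn_add |f'| (-f'),
        Lp.coeFn_abs f', Lp.coeFn_neg f'] with X h1 h2 h3 h4 h5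
      rw [h1, h2, Pi.smul_apply, h3, Pi.add_apply, h4, h5, Pi.neg_apply, smul_eq_mul]
      rcases le_total 0 (r X) with h | h
      · rw [max_eq_right (by linarith), abs_of_nonneg h]; ring
      · rw [max_eq_left (by linarith), abs_of_nonpos h]; ring
    have hpeig : fkL2 v L t p = ‖fkL2 (N := N) v L t‖ • p := by
      rw [hp_eq, (fkL2 (N := N) v L t).map_smul, (fkL2 (N := N) v L t).map_add, habs, hf'eig,
        ← smul_add, smul_comm]
    have hqeig : fkL2 v L t q = ‖fkL2 (N := N) v L t‖ • q := by
      rw [hq_eq, (fkL2 (N := N) v L t).map_smul, (fkL2 (N := N) v L t).map_add,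
        (fkL2 (N := N) v L t).map_neg, habs, hf'eig, ← smul_neg, ← smul_add, smul_comm]
    have hp0 : 0 ≤ p := by
      rw [← Lp.coeFn_nonneg]
      filter_upwards [hpc] with X hX
      rw [hX]; exact le_max_right _ _
    have hq0 : 0 ≤ q := by
      rw [← Lp.coeFn_nonneg]
      filter_upwards [hqc] with X hX
      rw [hX]; exact le_max_right _ _
    -- not both parts vanish
    have hpq : ¬ (p = 0 ∧ q = 0) := by
      rintro ⟨hp, hq⟩
      apply hz
      refine Lp.eq_zero_iff_ae_eq_zero.2 ?_
      have h1 : (p : Config N → ℝ) =ᵐ[volume.restrict (boxN N L)] 0 := Lp.eq_zero_iff_ae_eq_zero.1 hp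
      have h2 : (q : Config N → ℝ) =ᵐ[volume.restrict (boxN N L)] 0 := Lp.eq_zero_iff_ae_eq_zero.1 hq
      filter_upwards [h1, h2, hpc, hqc] with X a1 a2 a3 a4
      rw [a3] at a1
      rw [a4] at a2
      simp only [Pi.zero_apply] at a1 a2 ⊢
      have b1 : r X ≤ 0 := by have := le_max_left (r X) 0; linarith
      have b2 : -r X ≤ 0 := by have := le_max_left (-r X) 0; linarith
      show r X = 0
      linarith
    -- strict sign of `f'` a.e.
    have hsign : (∀ᵐ X ∂volume.restrict (boxN N L), 0 < r X) ∨
        (∀ᵐ X ∂volume.restrict (boxN N L), r X < 0) := by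
      by_cases hp : p = 0
      · -- `q ≠ 0`: `r < 0` a.e.
        have hq : q ≠ 0 := fun hq => hpq ⟨hp, hq⟩
        right
        filter_upwards [fkL2_coeFn_pos_of_eigenvector hv hC L ht hT0 hq0 hq hqeig, hqc] with X a1 a2
        rw [a2] at a1
        by_contra hge
        have : max (-r X) 0 = 0 := max_eq_right (by linarith [not_lt.1 hge])
        rw [this] at a1
        exact lt_irrefl 0 a1
      · left
        filter_upwards [fkL2_coeFn_pos_of_eigenvector hv hC L ht hT0 hp0 hp hpeig, hpc] with X a1 a2
        rw [a2] at a1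
        by_contra hle
        have : max (r X) 0 = 0 := max_eq_right (not_lt.1 hle)
        rw [this] at a1
        exact lt_irrefl 0 a1
    rcases hsign with hs | hs
    · have := inner_pos_of_ae_pos hμ0 hepos hs
      rw [hf'e] at this
      exact lt_irrefl _ this
    · have hneg : ∀ᵐ X ∂volume.restrict (boxN N L),
          0 < ((-f' : Lp ℝ 2 (volume.restrict (boxN N L))) : Config N → ℝ) X := by
        filter_upwards [hs, Lp.coeFn_neg f'] with X h1 h2
        rw [h2, Pi.neg_apply]
        simp only [hr] at h1
        linarith
      have := inner_pos_of_ae_pos hμ0 hepos hneg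
      rw [inner_neg_right, hf'e, neg_zero] at this
      exact lt_irrefl _ this

/-- **Perron–Frobenius for `e^{-tH_N}` on `L²(Λ_L^N)`** (`t > 0`, `L > 0`, `v` measurable and
bounded). The compact positive self-adjoint positivity-improving operator `T = fkL2 v L t` is
nonzero and has a unit eigenvector `e ≥ 0` for the eigenvalue `‖T‖`, a.e. strictly positive on
the box, and every eigenvector for `‖T‖` is a multiple of `e` (nondegenerate ground state).
Reed–Simon IV Thm XIII.44; Glimm–Jaffe Thms 3.3.2–3.3.3; Chung–Zhao (1995) Thm 8.11 and its
Corollary. [cite: ReedSimonIV1978, Thm XIII.44] -/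
theorem fkL2_perronFrobenius {v : ℝ → ℝ≥0∞} (hv : Measurable v) {C : ℝ≥0} (hC : ∀ r, v r ≤ C)
    {L : ℝ} (hL : 0 < L) {t : ℝ} (ht : 0 < t) :
    fkL2 (N := N) v L t ≠ 0 ∧ ∃ e : Lp ℝ 2 (volume.restrict (boxN N L)),
      ‖e‖ = 1 ∧ 0 ≤ e ∧ fkL2 v L t e = ‖fkL2 (N := N) v L t‖ • e ∧
      (∀ᵐ X ∂volume.restrict (boxN N L), 0 < (e : Config N → ℝ) X) ∧
      ∀ f, fkL2 v L t f = ‖fkL2 (N := N) v L t‖ • f → ∃ c : ℝ, f = c • e := by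
  set μ : Measure (Config N) := volume.restrict (boxN N L) with hμ
  haveI hfin : IsFiniteMeasure μ :=
    ⟨by rw [hμ, Measure.restrict_apply_univ]; exact volume_boxN_lt_top N L⟩
  have hμ0 : μ ≠ 0 := restrict_boxN_ne_zero N hL
  haveI : (ae μ).NeBot := ae_neBot.2 hμ0
  set T : Lp ℝ 2 μ →L[ℝ] Lp ℝ 2 μ := fkL2 v L t with hT
  have hsym : ∀ x y, ⟪T x, y⟫_ℝ = ⟪x, T y⟫_ℝ := fun x y => inner_fkL2_comm hv L ht x y
  have hposT : ∀ x, 0 ≤ ⟪T x, x⟫_ℝ := fun x => inner_fkL2_self_nonneg hv L ht x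
  have hc : IsCompactOperator T := isCompactOperator_fkL2 hv hC hL ht
  -- `T ≠ 0`: the constant `1` is mapped to an a.e. positive function
  have hT0 : T ≠ 0 := by
    set g₁ : Lp ℝ 2 μ := indicatorConstLp 2 MeasurableSet.univ (measure_ne_top μ _) (1 : ℝ) with hg₁
    have hg₁0 : 0 ≤ g₁ := by
      rw [← Lp.coeFn_nonneg]
      filter_upwards [indicatorConstLp_coeFn (p := 2) (μ := μ) (s := Set.univ) (hs := MeasurableSet.univ)
        (hμs := measure_ne_top μ _) (c := (1 : ℝ))] with X hX
      rw [hX]; simp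
    have hg₁ne : g₁ ≠ 0 := by
      intro h0
      have h1 : (g₁ : Config N → ℝ) =ᵐ[μ] 0 := Lp.eq_zero_iff_ae_eq_zero.1 h0
      have h2 := indicatorConstLp_coeFn (p := 2) (μ := μ) (s := Set.univ) (hs := MeasurableSet.univ)
        (hμs := measure_ne_top μ _) (c := (1 : ℝ))
      obtain ⟨X, hX1, hX2⟩ := (h1.and h2).exists
      rw [hX2] at hX1
      simp at hX1
    intro hT0
    have hpos := fkL2_coeFn_pos hv hC L ht hg₁0 hg₁ne
    have hzero : (T g₁ : Config N → ℝ) =ᵐ[μ] 0 := by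
      rw [hT0]; exact Lp.coeFn_zero _ _ _
    obtain ⟨X, h1, h2⟩ := (hpos.and hzero).exists
    rw [h2] at h1
    exact lt_irrefl _ h1
  -- the eigenvector
  obtain ⟨e₀, he₀, hTe₀⟩ := exists_eigenvector_norm T hsym hposT hc hT0
  set e : Lp ℝ 2 μ := |e₀| with he
  have he1 : ‖e‖ = 1 := by rw [he, norm_abs_eq_norm, he₀]
  have he0 : 0 ≤ e := by rw [he]; exact abs_nonneg e₀
  have hTe : T e = ‖T‖ • e := by rw [he]; exact fkL2_abs_eigenvector hv L ht hTe₀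
  clear_value e
  have hene : e ≠ 0 := fun h0 => by rw [h0, norm_zero] at he1; exact zero_ne_one he1
  have hepos : ∀ᵐ X ∂μ, 0 < (e : Config N → ℝ) X :=
    fkL2_coeFn_pos_of_eigenvector hv hC L ht hT0 he0 hene hTe
  exact ⟨hT0, e, he1, he0, hTe, hepos, fun f hf =>
    fkL2_eigenvector_smul_of_pos hv hC hL ht hT0 he1 hTe hepos f hf⟩

end Literature.MathematicalPhysics.QuantumManyBody.BoseGas

end
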